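import Literature.NumberTheory.Automorphic.LocalUnitaryGroupCongr          -- ★ `cmDatumLocalCongr`, `coe_cmDatumLocalCongr_apply` (`T g T⁻¹`, `rfl`)
import Literature.NumberTheory.Automorphic.UnitaryConjClassClosed           -- ★ `formCongr_mul` (`Q(h a) = σ(a)ᵀ Q(h) a`)
import Literature.NumberTheory.Automorphic.IrreducibleClassesComap          -- ★ `IrrClass.comap`, `comap_symm_comap`
import HarnessLib

/-!
# R90-TF · S4 (Ch. 13.1–2) · socket S4#B2 road, step F1 — similitude conjugacy of classes of `U(Φ₂)(L⁺_v)` is an EQUIVALENCE RELATION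

Cell `hodgecm-mathlib`, crux H413 (`stmt-HodgeConjecture-24833`), route of record `HCCMUnconditional`; programme R90-TF (brief
`director/R90-BRIEF.v2.md`), section S4 = Rogawski Ch. 13.1–2, seat `R90-C131-p02 (g0)`, DEAL-S4-WAVE1 (K2E2-plan g6) hand p02 = socket
S4#B2 `stub_R90_S4_H_disjoint` of `Cruxes/H413/Lines/R90_S4_HPacketsU2B.lean` (:327), ROAD «`IsU2SimilConj` EQUIVALENCE RELATION + ★
`boxChar_eq_boxChar_iff` JOINT RIGIDITY».  PROOF lane, theorems only (no `def`, no instance, no notation, no `sorry`);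
`--supports stmt-HodgeConjecture-24833 --as helper`.  Lines-free (a `Theorems/` file cannot import `Cruxes/…/Lines/…`, CONVENTIONS §2), so
every statement is BY NAME-SHAPE: the relation below is the BODY of the line's `IsU2SimilConj L v σ σ′` («`σ′` is a `G_ad(F)`-conjugate of
`σ`»: `∃ T a ha h, σ′ = IrrClass.comap (cmDatumLocalCongr L v T ha h) σ`, `T ∈ GL₂(L ⊗ L⁺_v)` a similitude of the split form `Φ₂`,
`ᵗT̄ Φ₂ T = a Φ₂`, `a` a unit), with `Φ₂Loc`, `U2Loc` unfolded to the literal matrix `(i, j) ↦ [i + j + 1 = 2]` and `(cmDatum L 2 Φ₂).Local v`.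

THE MATHEMATICS [Rogawski1990, §11.1 p. 161: «An L-packet on `G` is, by definition, a `PGL₂(F)`-orbit in `E(G)`»; an ORBIT
decomposition presupposes that conjugacy is an equivalence relation].  Conjugation by a similitude `T` is the isomorphism of topological
groups ★ `cmDatumLocalCongr L v T ha h : U(Φ₂)_v ≃ₜ* U(Φ₂)_v`, `g ↦ T g T⁻¹` ([PlatonovRapinchuk1994, §2.3]); pulling a class back along it is
★ `IrrClass.comap` ([BushnellHenniart2006, §1.1]).  Three bookkeeping identities of similitudes —
  `T = 1` has multiplier `1` and acts as the identity;  `T⁻¹` has multiplier `a⁻¹` and `E_{T⁻¹} = E_T⁻¹`;  `T T′` has multiplier `a a′` and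
  `E_{T T′} = E_{T′} ≫ E_T` (first `T′ g T′⁻¹`, then conjugate by `T`) —
together with the functoriality of `IrrClass.comap` (`comap refl = id`, `comap e′ ∘ comap e = comap (e′ ≫ e)`, ★ `comap_symm_comap`) give
reflexivity, symmetry and transitivity.  The `a`-slots compose as the socket's docstring predicts (`a a′`, absorbed by ★ `cmDatumLocalCongr`,
whose map does not depend on `a`).

CONTENTS (all sorry-free):
* §1 generic functoriality of ★ `IrrClass.comap`: `irrClass_comap_refl`, `irrClass_comap_comap` (any isomorphic topological groups, one universe);
* §2 similitude algebra over `L ⊗ L⁺_v` in ★ `formCongr` currency (any rank `N`, any `H, H′, H″`): `formCongr_inv_eq_smul_of_eq_smul`,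
  `formCongr_mul_eq_smul_of_eq_smul`, and the three identities of ★ `cmDatumLocalCongr` as continuous isomorphisms:
  `cmDatumLocalCongr_one_eq_refl`, `cmDatumLocalCongr_symm_eq_inv`, `cmDatumLocalCongr_trans_eq_mul`;
* §3 the relation of record on `Irr(U(Φ₂)(L⁺_v))`: `u2SimilConj_refl`, `u2SimilConj_symm`, `u2SimilConj_trans`, and the headline
  **`isU2SimilConj_equivalence : Equivalence (fun σ σ′ => ∃ T a ha h, σ′ = comap (cmDatumLocalCongr L v T ha h) σ)`**.
Consumed by `Theorems/R90S4HDisjoint.lean` (two `H_v`-packets sharing a member coincide).  HONEST LABEL: nothing here closes S4#B2 by itself;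
REL ≠ ★ ≠ BUILT; HC_CM is proved only modulo the 7 printed citations (2 remaining named inputs: hLiu418 = stmt-HodgeConjecture-24832,
h413 = stmt-HodgeConjecture-24833) until rung 0 closes.

## References
* [Rogawski1990] J. D. Rogawski, *Automorphic Representations of Unitary Groups in Three Variables*, Ann. of Math. Stud. 123 (1990), §11.1 p. 161; §12.1 p. 171.
* [PlatonovRapinchuk1994] V. Platonov, A. Rapinchuk, *Algebraic Groups and Number Theory* (1994), §2.3.
* [BushnellHenniart2006] C. J. Bushnell, G. Henniart, *The Local Langlands Conjecture for GL(2)*, Grundlehren 335 (2006), §1.1.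
-/

set_option autoImplicit false
-- the mandated namespace repeats the single-problem summit's segment (`HodgeConjecture.HodgeConjecture`)
set_option linter.dupNamespace false

noncomputable section

open NumberField IsDedekindDomain
open scoped Matrix MatrixGroups
open Literature.NumberTheory.Automorphic Literature.NumberTheory.Automorphic.UnitaryGroup

namespace Summit.HodgeConjecture.HodgeConjecture.R90.S4

/-! ## §1 Functoriality of ★ `IrrClass.comap` (generic) -/

section Generic

universe u

variable {G G' G'' : Type u} [Group G] [TopologicalSpace G] [Group G'] [TopologicalSpace G'] [Group G''] [TopologicalSpace G'']

/-- **`comap` along the identity is the identity**: `⟦r ∘ id⟧ = ⟦r⟧` (the identity linear map intertwines). [cite: BushnellHenniart2006, §1.1] -/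
theorem irrClass_comap_refl (c : IrrClass G) : IrrClass.comap (ContinuousMulEquiv.refl G) c = c := by
  induction c using Quotient.inductionOn with
  | h r =>
    refine Quotient.sound ((SmoothIrrep.equiv_iff _ _).2 ⟨Representation.Equiv.mk (LinearEquiv.refl ℂ r.V) fun g => ?_⟩)
    refine LinearMap.ext fun v => ?_
    rfl

/-- **`comap` is functorial**: `⟦(r ∘ e) ∘ e′⟧ = ⟦r ∘ (e′ ≫ e)⟧` for `e : G′ ≃ₜ* G`, `e′ : G″ ≃ₜ* G′` (same space, same operators
`r.ρ (e (e′ g″))`; the identity linear map intertwines). [cite: BushnellHenniart2006, §1.1] -/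
theorem irrClass_comap_comap (e : G' ≃ₜ* G) (e' : G'' ≃ₜ* G') (c : IrrClass G) :
    IrrClass.comap e' (IrrClass.comap e c) = IrrClass.comap (e'.trans e) c := by
  induction c using Quotient.inductionOn with
  | h r =>
    refine Quotient.sound ((SmoothIrrep.equiv_iff _ _).2 ⟨Representation.Equiv.mk (LinearEquiv.refl ℂ r.V) fun g => ?_⟩)
    refine LinearMap.ext fun v => ?_
    rfl

end Generic

/-! ## §2 Similitude algebra over `L ⊗ L⁺_v` and the three identities of ★ `cmDatumLocalCongr` -/

section Simil

variable (L : Type) [Field L] [NumberField L] [IsCMField L] {N : ℕ} (v : HeightOneSpectrum (𝓞 ↥(maximalRealSubfield L)))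

/-- **The inverse of a similitude is a similitude with the inverse multiplier**: from `ᵗT̄ · H_v · T = a • H′_v` (`a` a unit),
`ᵗ(T̄⁻¹) · H′_v · T⁻¹ = a⁻¹ • H_v` (change the basis back: ★ `formCongr_inv_formCongr`). [cite: PlatonovRapinchuk1994, §2.3] -/
theorem formCongr_inv_eq_smul_of_eq_smul {H H' : Matrix (Fin N) (Fin N) L} (T : GL (Fin N) (LocalRing L v)) {a : LocalRing L v}
    (ha : IsUnit a)
    (h : formCongr (conjLocal L (IsCMField.complexConj L) v) T (H.map (algebraMap L (LocalRing L v))) =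
      a • H'.map (algebraMap L (LocalRing L v))) :
    formCongr (conjLocal L (IsCMField.complexConj L) v) T⁻¹ (H'.map (algebraMap L (LocalRing L v))) =
      ((ha.unit⁻¹ : (LocalRing L v)ˣ) : LocalRing L v) • H.map (algebraMap L (LocalRing L v)) := by
  -- `a • ᵗ(T̄⁻¹) H′_v T⁻¹ = ᵗ(T̄⁻¹) (a • H′_v) T⁻¹ = ᵗ(T̄⁻¹) (ᵗT̄ H_v T) T⁻¹ = H_v`
  have key : a • formCongr (conjLocal L (IsCMField.complexConj L) v) T⁻¹ (H'.map (algebraMap L (LocalRing L v))) =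
      H.map (algebraMap L (LocalRing L v)) := by
    have hs : formCongr (conjLocal L (IsCMField.complexConj L) v) T⁻¹ (a • H'.map (algebraMap L (LocalRing L v))) =
        a • formCongr (conjLocal L (IsCMField.complexConj L) v) T⁻¹ (H'.map (algebraMap L (LocalRing L v))) := by
      simp only [formCongr, Matrix.mul_smul, Matrix.smul_mul]
    rw [← hs, ← h, formCongr_inv_formCongr]
  calc formCongr (conjLocal L (IsCMField.complexConj L) v) T⁻¹ (H'.map (algebraMap L (LocalRing L v)))
      = (((ha.unit⁻¹ : (LocalRing L v)ˣ) : LocalRing L v) * a) •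
          formCongr (conjLocal L (IsCMField.complexConj L) v) T⁻¹ (H'.map (algebraMap L (LocalRing L v))) := by
        rw [IsUnit.val_inv_mul, one_smul]
    _ = ((ha.unit⁻¹ : (LocalRing L v)ˣ) : LocalRing L v) • H.map (algebraMap L (LocalRing L v)) := by
        rw [mul_smul, key]

/-- **The product of two similitudes is a similitude with the product multiplier**: from `ᵗT̄ · H_v · T = a • H′_v` and
`ᵗT̄′ · H′_v · T′ = a′ • H″_v`, `ᵗ(T T′)‾ · H_v · (T T′) = (a a′) • H″_v` (★ `formCongr_mul`). [cite: PlatonovRapinchuk1994, §2.3] -/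
theorem formCongr_mul_eq_smul_of_eq_smul {H H' H'' : Matrix (Fin N) (Fin N) L} (T T' : GL (Fin N) (LocalRing L v))
    {a a' : LocalRing L v}
    (h : formCongr (conjLocal L (IsCMField.complexConj L) v) T (H.map (algebraMap L (LocalRing L v))) =
      a • H'.map (algebraMap L (LocalRing L v)))
    (h' : formCongr (conjLocal L (IsCMField.complexConj L) v) T' (H'.map (algebraMap L (LocalRing L v))) =
      a' • H''.map (algebraMap L (LocalRing L v))) :
    formCongr (conjLocal L (IsCMField.complexConj L) v) (T * T') (H.map (algebraMap L (LocalRing L v))) =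
      (a * a') • H''.map (algebraMap L (LocalRing L v)) := by
  have hs : formCongr (conjLocal L (IsCMField.complexConj L) v) T' (a • H'.map (algebraMap L (LocalRing L v))) =
      a • formCongr (conjLocal L (IsCMField.complexConj L) v) T' (H'.map (algebraMap L (LocalRing L v))) := by
    simp only [formCongr, Matrix.mul_smul, Matrix.smul_mul]
  rw [formCongr_mul, h, hs, h', smul_smul]

/-- **`T = 1` acts as the identity**: ★ `cmDatumLocalCongr L v 1 _ _` is `ContinuousMulEquiv.refl` (`1 g 1⁻¹ = g`), whatever the
multiplier slot. [cite: PlatonovRapinchuk1994, §2.3] -/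
theorem cmDatumLocalCongr_one_eq_refl {H : Matrix (Fin N) (Fin N) L} {a : LocalRing L v} (ha : IsUnit a)
    (h : formCongr (conjLocal L (IsCMField.complexConj L) v) (1 : GL (Fin N) (LocalRing L v)) (H.map (algebraMap L (LocalRing L v))) =
      a • H.map (algebraMap L (LocalRing L v))) :
    cmDatumLocalCongr L v (1 : GL (Fin N) (LocalRing L v)) ha h = ContinuousMulEquiv.refl ((cmDatum L N H).Local v) := by
  refine ContinuousMulEquiv.ext fun g => Subtype.ext ?_
  rw [coe_cmDatumLocalCongr_apply, ContinuousMulEquiv.refl_apply, inv_one, one_mul, mul_one]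

/-- **`E_T⁻¹ = E_{T⁻¹}`**: the inverse of conjugation by `T` (`g ↦ T⁻¹ g T`) IS conjugation by the similitude `T⁻¹`, whatever
multiplier slot the latter is given. [cite: PlatonovRapinchuk1994, §2.3] -/
theorem cmDatumLocalCongr_symm_eq_inv {H H' : Matrix (Fin N) (Fin N) L} (T : GL (Fin N) (LocalRing L v)) {a a' : LocalRing L v}
    (ha : IsUnit a)
    (h : formCongr (conjLocal L (IsCMField.complexConj L) v) T (H.map (algebraMap L (LocalRing L v))) =
      a • H'.map (algebraMap L (LocalRing L v)))
    (ha' : IsUnit a')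
    (h' : formCongr (conjLocal L (IsCMField.complexConj L) v) T⁻¹ (H'.map (algebraMap L (LocalRing L v))) =
      a' • H.map (algebraMap L (LocalRing L v))) :
    (cmDatumLocalCongr L v T ha h).symm = cmDatumLocalCongr L v T⁻¹ ha' h' := by
  refine ContinuousMulEquiv.ext fun g => Subtype.ext ?_
  rw [coe_cmDatumLocalCongr_apply, inv_inv]
  rfl

/-- **`E_{T′} ≫ E_T = E_{T T′}`**: conjugating by `T′` and then by `T` is conjugating by `T T′` (`T (T′ g T′⁻¹) T⁻¹ = (T T′) g (T T′)⁻¹`),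
whatever multiplier slot the product is given. [cite: PlatonovRapinchuk1994, §2.3] -/
theorem cmDatumLocalCongr_trans_eq_mul {H H' H'' : Matrix (Fin N) (Fin N) L} (T T' : GL (Fin N) (LocalRing L v))
    {a a' a'' : LocalRing L v} (ha : IsUnit a)
    (h : formCongr (conjLocal L (IsCMField.complexConj L) v) T (H.map (algebraMap L (LocalRing L v))) =
      a • H'.map (algebraMap L (LocalRing L v)))
    (ha' : IsUnit a')
    (h' : formCongr (conjLocal L (IsCMField.complexConj L) v) T' (H'.map (algebraMap L (LocalRing L v))) =
      a' • H''.map (algebraMap L (LocalRing L v)))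
    (ha'' : IsUnit a'')
    (h'' : formCongr (conjLocal L (IsCMField.complexConj L) v) (T * T') (H.map (algebraMap L (LocalRing L v))) =
      a'' • H''.map (algebraMap L (LocalRing L v))) :
    (cmDatumLocalCongr L v T' ha' h').trans (cmDatumLocalCongr L v T ha h) = cmDatumLocalCongr L v (T * T') ha'' h'' := by
  refine ContinuousMulEquiv.ext fun g => Subtype.ext ?_
  rw [ContinuousMulEquiv.trans_apply, coe_cmDatumLocalCongr_apply, coe_cmDatumLocalCongr_apply, coe_cmDatumLocalCongr_apply,
    mul_inv_rev]
  simp only [mul_assoc]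

end Simil

/-! ## §3 Similitude conjugacy of classes of `U(Φ₂)(L⁺_v)` — the body of the line's `IsU2SimilConj L v` — is an equivalence relation -/

section U2

variable (L : Type) [Field L] [NumberField L] [IsCMField L] (v : HeightOneSpectrum (𝓞 ↥(maximalRealSubfield L)))

/-- **Reflexivity** (`T = 1`, multiplier `1`): every class is similitude-conjugate to itself. NAME-SHAPE of the line's
`isU2SimilConj_refl` (re-proved Lines-free). [cite: Rogawski1990, §11.1 p. 161] -/
theorem u2SimilConj_refl
    (σ : IrrClass ((cmDatum L 2 (Matrix.of fun i j : Fin 2 => if i.val + j.val + 1 = 2 then (1 : L) else 0)).Local v)) :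
    ∃ (T : GL (Fin 2) (LocalRing L v)) (a : LocalRing L v) (ha : IsUnit a)
      (h : formCongr (conjLocal L (IsCMField.complexConj L) v) T
          ((Matrix.of fun i j : Fin 2 => if i.val + j.val + 1 = 2 then (1 : L) else 0).map (algebraMap L (LocalRing L v))) =
        a • (Matrix.of fun i j : Fin 2 => if i.val + j.val + 1 = 2 then (1 : L) else 0).map (algebraMap L (LocalRing L v))),
      σ = IrrClass.comap (cmDatumLocalCongr L v T ha h) σ := by
  have h1 : formCongr (conjLocal L (IsCMField.complexConj L) v) (1 : GL (Fin 2) (LocalRing L v))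
      ((Matrix.of fun i j : Fin 2 => if i.val + j.val + 1 = 2 then (1 : L) else 0).map (algebraMap L (LocalRing L v))) =
      (1 : LocalRing L v) • (Matrix.of fun i j : Fin 2 => if i.val + j.val + 1 = 2 then (1 : L) else 0).map (algebraMap L (LocalRing L v)) := by
    simp [formCongr, Matrix.map_one]
  refine ⟨1, 1, isUnit_one, h1, ?_⟩
  rw [cmDatumLocalCongr_one_eq_refl L v isUnit_one h1, irrClass_comap_refl]

/-- **Symmetry** (`T ↦ T⁻¹`, multiplier `a ↦ a⁻¹`): if `σ′ = σ ∘ Ad(T)` then `σ = σ′ ∘ Ad(T⁻¹)` (★ `comap_symm_comap` and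
`E_T⁻¹ = E_{T⁻¹}`). [cite: Rogawski1990, §11.1 p. 161] -/
theorem u2SimilConj_symm
    {σ σ' : IrrClass ((cmDatum L 2 (Matrix.of fun i j : Fin 2 => if i.val + j.val + 1 = 2 then (1 : L) else 0)).Local v)}
    (hσ : ∃ (T : GL (Fin 2) (LocalRing L v)) (a : LocalRing L v) (ha : IsUnit a)
      (h : formCongr (conjLocal L (IsCMField.complexConj L) v) T
          ((Matrix.of fun i j : Fin 2 => if i.val + j.val + 1 = 2 then (1 : L) else 0).map (algebraMap L (LocalRing L v))) =
        a • (Matrix.of fun i j : Fin 2 => if i.val + j.val + 1 = 2 then (1 : L) else 0).map (algebraMap L (LocalRing L v))),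
      σ' = IrrClass.comap (cmDatumLocalCongr L v T ha h) σ) :
    ∃ (T : GL (Fin 2) (LocalRing L v)) (a : LocalRing L v) (ha : IsUnit a)
      (h : formCongr (conjLocal L (IsCMField.complexConj L) v) T
          ((Matrix.of fun i j : Fin 2 => if i.val + j.val + 1 = 2 then (1 : L) else 0).map (algebraMap L (LocalRing L v))) =
        a • (Matrix.of fun i j : Fin 2 => if i.val + j.val + 1 = 2 then (1 : L) else 0).map (algebraMap L (LocalRing L v))),
      σ = IrrClass.comap (cmDatumLocalCongr L v T ha h) σ' := by
  obtain ⟨T, a, ha, h, rfl⟩ := hσ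
  refine ⟨T⁻¹, ((ha.unit⁻¹ : (LocalRing L v)ˣ) : LocalRing L v), (ha.unit⁻¹).isUnit,
    formCongr_inv_eq_smul_of_eq_smul L v T ha h, ?_⟩
  rw [← cmDatumLocalCongr_symm_eq_inv L v T ha h (ha.unit⁻¹).isUnit (formCongr_inv_eq_smul_of_eq_smul L v T ha h),
    IrrClass.comap_symm_comap]

/-- **Transitivity** (`(T, T′) ↦ T T′`, multipliers `a a′`): if `σ′ = σ ∘ Ad(T)` and `σ″ = σ′ ∘ Ad(T′)` then `σ″ = σ ∘ Ad(T T′)`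
(`comap` functoriality and `E_{T′} ≫ E_T = E_{T T′}`). [cite: Rogawski1990, §11.1 p. 161] -/
theorem u2SimilConj_trans
    {σ σ' σ'' : IrrClass ((cmDatum L 2 (Matrix.of fun i j : Fin 2 => if i.val + j.val + 1 = 2 then (1 : L) else 0)).Local v)}
    (hσ : ∃ (T : GL (Fin 2) (LocalRing L v)) (a : LocalRing L v) (ha : IsUnit a)
      (h : formCongr (conjLocal L (IsCMField.complexConj L) v) T
          ((Matrix.of fun i j : Fin 2 => if i.val + j.val + 1 = 2 then (1 : L) else 0).map (algebraMap L (LocalRing L v))) =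
        a • (Matrix.of fun i j : Fin 2 => if i.val + j.val + 1 = 2 then (1 : L) else 0).map (algebraMap L (LocalRing L v))),
      σ' = IrrClass.comap (cmDatumLocalCongr L v T ha h) σ)
    (hσ' : ∃ (T : GL (Fin 2) (LocalRing L v)) (a : LocalRing L v) (ha : IsUnit a)
      (h : formCongr (conjLocal L (IsCMField.complexConj L) v) T
          ((Matrix.of fun i j : Fin 2 => if i.val + j.val + 1 = 2 then (1 : L) else 0).map (algebraMap L (LocalRing L v))) =
        a • (Matrix.of fun i j : Fin 2 => if i.val + j.val + 1 = 2 then (1 : L) else 0).map (algebraMap L (LocalRing L v))),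
      σ'' = IrrClass.comap (cmDatumLocalCongr L v T ha h) σ') :
    ∃ (T : GL (Fin 2) (LocalRing L v)) (a : LocalRing L v) (ha : IsUnit a)
      (h : formCongr (conjLocal L (IsCMField.complexConj L) v) T
          ((Matrix.of fun i j : Fin 2 => if i.val + j.val + 1 = 2 then (1 : L) else 0).map (algebraMap L (LocalRing L v))) =
        a • (Matrix.of fun i j : Fin 2 => if i.val + j.val + 1 = 2 then (1 : L) else 0).map (algebraMap L (LocalRing L v))),
      σ'' = IrrClass.comap (cmDatumLocalCongr L v T ha h) σ := by
  obtain ⟨T, a, ha, h, rfl⟩ := hσ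
  obtain ⟨T', a', ha', h', rfl⟩ := hσ'
  refine ⟨T * T', a * a', ha.mul ha', formCongr_mul_eq_smul_of_eq_smul L v T T' h h', ?_⟩
  rw [irrClass_comap_comap, cmDatumLocalCongr_trans_eq_mul L v T T' ha h ha' h' (ha.mul ha')
    (formCongr_mul_eq_smul_of_eq_smul L v T T' h h')]

/-- **HEADLINE (F1 of socket S4#B2's road) — similitude conjugacy is an EQUIVALENCE RELATION on `Irr(U(Φ₂)(L⁺_v))`.**  The relation is
the body of the line's `IsU2SimilConj L v` (file B `Cruxes/H413/Lines/R90_S4_HPacketsU2B.lean` §1), BY NAME-SHAPE: `σ′ = σ ∘ Ad(T)` for a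
similitude `T ∈ GL₂(L ⊗ L⁺_v)` of `Φ₂` (`ᵗT̄ Φ₂ T = a Φ₂`, `a` a unit).  Hence its orbits — the printed L-packets of `U(2)`, «by definition,
a `PGL₂(F)`-orbit in `E(G)`» — partition `Irr`, which is what the disjointness socket consumes. [cite: Rogawski1990, §11.1 p. 161]
[cite: PlatonovRapinchuk1994, §2.3] -/
theorem isU2SimilConj_equivalence :
    Equivalence fun σ σ' : IrrClass ((cmDatum L 2 (Matrix.of fun i j : Fin 2 => if i.val + j.val + 1 = 2 then (1 : L) else 0)).Local v) =>
      ∃ (T : GL (Fin 2) (LocalRing L v)) (a : LocalRing L v) (ha : IsUnit a)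
        (h : formCongr (conjLocal L (IsCMField.complexConj L) v) T
            ((Matrix.of fun i j : Fin 2 => if i.val + j.val + 1 = 2 then (1 : L) else 0).map (algebraMap L (LocalRing L v))) =
          a • (Matrix.of fun i j : Fin 2 => if i.val + j.val + 1 = 2 then (1 : L) else 0).map (algebraMap L (LocalRing L v))),
        σ' = IrrClass.comap (cmDatumLocalCongr L v T ha h) σ :=
  ⟨u2SimilConj_refl L v, u2SimilConj_symm L v, u2SimilConj_trans L v⟩

end U2

end Summit.HodgeConjecture.HodgeConjecture.R90.S4

end
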